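import Mathlib
import HarnessLib
import Summits.AtomisticToContinuum.FouriersLaw.Theses.BoundaryEscapeDeficit

/-!
# Crux-strategist s2 artifact for `BoundaryEscapeDeficit.HalfChainTailLaw` (stmt-AtomisticToContinuum-12235):
# the lossless WINDOW TRICHOTOMY  `HalfChainTailLaw ⟺ SumRule ∧ WindowCeiling ∧ WindowGain`

Census heading `## Decomposition` (best typed split), kernel-checked in BOTH directions over the route's own vocabulary.

Notation (VERBATIM the `let P / K / θ` of the route file): `K_M(u) = ∫ (p₀² − T)·P_u(p₀² − T) dμ_T^M`,
`θ_M(t) = (γ/T²)∫₀ᵗ K_M`.  The crux says `∃ c C t₀ > 0, ∀ t ≥ t₀, ∀ᶠ M, c/√t ≤ 1 − θ_M(t) ≤ C/√t`.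

The three pieces (all stated, like the crux, "eventually in the length `M`" — no half-line limit object is needed):

* `SumRule` — the route's OWN support item (stmt-AtomisticToContinuum-12241, decl `BoundaryEscapeDeficit.SumRule`):
  `∀ ε > 0 ∃ t₁ ∀ t ≥ t₁, ∀ᶠ M, |1 − θ_M(t)| ≤ ε` (complete boundary thermalisation of the half-line = NO BALLISTIC CHANNEL;
  qualitative, `t → ∞`; FALSE at the harmonic corner).
* `WindowCeiling` — `∃ C u₀ > 0, ∀ u₀ ≤ a ≤ b, ∀ᶠ M, θ_M(b) − θ_M(a) ≤ C/√a`: the boundary-temperature GAIN over any later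
  window is at most `C/√a` ((γ/T²)∫ₐᵇ K_M ≤ C/√a: the RETURNING part of a boundary energy fluctuation returns no slower than
  diffusively = NO SUPER-DIFFUSIVE RECURRENT CHANNEL; quantitative but time-LOCAL; TRUE at the harmonic corner, where
  `∫ₐᵇ K^harm ≲ a⁻²`).
* `WindowGain` — `∃ c u₀ > 0, ∃ r > 1, ∀ a ≥ u₀, ∀ᶠ M, c/√a ≤ θ_M(r·a) − θ_M(a)`: over one geometric window the boundary still
  gains `≥ c/√a` (the DIFFUSIVE RECURRENCE FLOOR: boundary energy fluctuations DO come back at the first-return rate; time-local;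
  FALSE at the harmonic corner and for a sub-diffusive / localised bulk).

Theorems (sorry-free):
* abstract real analysis over an arbitrary `θ : ℕ → ℝ → ℝ`: `tail_of_sumRule_ceiling_gain`, `sumRule_of_tail`,
  `ceiling_of_tail`, `gain_of_tail`, `tail_iff`;
* over the route decls: `halfChainTailLaw_of_sumRule_windowCeiling_windowGain : SumRule → WindowCeiling → WindowGain →
  HalfChainTailLaw`, the three converses, and `halfChainTailLaw_iff : HalfChainTailLaw ↔ SumRule ∧ WindowCeiling ∧ WindowGain`.

Reading for the census: the split is LOSSLESS (an `iff`), no piece is the crux reworded (truth tables at the harmonic corner: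
SumRule F / WindowCeiling T / WindowGain F, crux F; under a sub-diffusive bulk: T / T / F; under a super-diffusive recurrent bulk:
T / F / T), and every piece is an `M`-uniform infrared statement about the deterministic anharmonic bulk with no supplier in tree
or print — see `STRATEGY-CENSUS.md` §Decomposition for why this is recorded and NOT filed as a route-level split.
-/

noncomputable section

namespace Summit.AtomisticToContinuum.FouriersLaw.Cruxes.HalfChainTailLaw.StrategistS2

open Filter Topology

/-! ## Abstract forms over an arbitrary family of curves `θ : ℕ → ℝ → ℝ` -/

/-- Abstract sum rule: `1 − θ_M(t) → 0` as `t → ∞`, eventually in `M` at each fixed `t`. -/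
def ASumRule (θ : ℕ → ℝ → ℝ) : Prop :=
  ∀ ε : ℝ, 0 < ε → ∃ t₁ : ℝ, ∀ t : ℝ, t₁ ≤ t → ∀ᶠ M : ℕ in atTop, |1 - θ M t| ≤ ε

/-- Abstract window ceiling: the gain of `θ_M` over any window `[a, b]` is at most `C/√a`, eventually in `M`. -/
def ACeiling (θ : ℕ → ℝ → ℝ) : Prop :=
  ∃ C u₀ : ℝ, 0 < u₀ ∧ ∀ a b : ℝ, u₀ ≤ a → a ≤ b → ∀ᶠ M : ℕ in atTop, θ M b - θ M a ≤ C / Real.sqrt a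

/-- Abstract window gain: over one geometric window `[a, r·a]` (`r > 1` fixed) `θ_M` gains at least `c/√a`, eventually in `M`. -/
def AGain (θ : ℕ → ℝ → ℝ) : Prop :=
  ∃ c u₀ r : ℝ, 0 < c ∧ 0 < u₀ ∧ 1 < r ∧
    ∀ a : ℝ, u₀ ≤ a → ∀ᶠ M : ℕ in atTop, c / Real.sqrt a ≤ θ M (r * a) - θ M a

/-- Abstract two-sided tail law (the shape of the crux). -/
def ATail (θ : ℕ → ℝ → ℝ) : Prop :=
  ∃ c C t₀ : ℝ, 0 < c ∧ 0 < t₀ ∧ ∀ t : ℝ, t₀ ≤ t → ∀ᶠ M : ℕ in atTop,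
    c / Real.sqrt t ≤ 1 - θ M t ∧ 1 - θ M t ≤ C / Real.sqrt t

/-- Iterating the window gain over `K ≥ 1` geometric windows: `θ_M(r^K a) − θ_M(a) ≥ c/√a` (only the first window is
used quantitatively; the later ones contribute nonnegative amounts). -/
theorem gain_iter {θ : ℕ → ℝ → ℝ} {c u₀ r : ℝ} (hc : 0 < c) (hu₀ : 0 < u₀) (hr : 1 < r)
    (hgain : ∀ a : ℝ, u₀ ≤ a → ∀ᶠ M : ℕ in atTop, c / Real.sqrt a ≤ θ M (r * a) - θ M a) :
    ∀ K : ℕ, 1 ≤ K → ∀ a : ℝ, u₀ ≤ a → ∀ᶠ M : ℕ in atTop, c / Real.sqrt a ≤ θ M (r ^ K * a) - θ M a := by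
  intro K hK
  induction K, hK using Nat.le_induction with
  | base =>
      intro a ha
      simpa only [pow_one] using hgain a ha
  | succ K hK ih =>
      intro a ha
      have hapos : 0 < a := lt_of_lt_of_le hu₀ ha
      have hrK : (1 : ℝ) ≤ r ^ K := one_le_pow₀ hr.le
      have ha' : u₀ ≤ r ^ K * a := by
        have : a ≤ r ^ K * a := by nlinarith
        exact le_trans ha this
      have h1 := ih a ha
      have h2 := hgain (r ^ K * a) ha'
      filter_upwards [h1, h2] with M hM1 hM2
      have hnn : 0 ≤ c / Real.sqrt (r ^ K * a) := div_nonneg hc.le (Real.sqrt_nonneg _)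
      have hpow : r ^ (K + 1) * a = r * (r ^ K * a) := by rw [pow_succ]; ring
      rw [hpow]
      linarith

/-- **Crux shape from the three pieces** (pure real analysis).  Constants: `c' = c/2`, `C' = C + c/2`,
`t₀' = max u₀(ceiling) u₀(gain)`. Upper: `1 − θ_M(t) = (1 − θ_M(b)) + (θ_M(b) − θ_M(t)) ≤ ε + C/√t` with `b` late enough for the
sum rule at `ε = c/(2√t)`.  Lower: telescope over `K ≥ 1` geometric windows until `r^K t` is late enough for the sum rule:
`1 − θ_M(t) ≥ c/√t − ε = c/(2√t)`. -/
theorem tail_of_sumRule_ceiling_gain {θ : ℕ → ℝ → ℝ} (hS : ASumRule θ) (hU : ACeiling θ) (hG : AGain θ) :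
    ATail θ := by
  obtain ⟨C, u₁, hu₁, hceil⟩ := hU
  obtain ⟨c, u₂, r, hc, hu₂, hr, hgain⟩ := hG
  refine ⟨c / 2, C + c / 2, max u₁ u₂, by positivity, lt_of_lt_of_le hu₁ (le_max_left _ _), ?_⟩
  intro t ht
  have ht₁ : u₁ ≤ t := le_trans (le_max_left _ _) ht
  have ht₂ : u₂ ≤ t := le_trans (le_max_right _ _) ht
  have htpos : 0 < t := lt_of_lt_of_le hu₁ ht₁
  have hsq : 0 < Real.sqrt t := Real.sqrt_pos.2 htpos
  set ε : ℝ := c / 2 / Real.sqrt t with hε_def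
  have hε : 0 < ε := by positivity
  obtain ⟨t₁, hSR⟩ := hS ε hε
  -- upper side: one late time `b`
  have hb1 : ∀ᶠ M : ℕ in atTop, |1 - θ M (max t t₁)| ≤ ε := hSR _ (le_max_right _ _)
  have hb2 : ∀ᶠ M : ℕ in atTop, θ M (max t t₁) - θ M t ≤ C / Real.sqrt t :=
    hceil t (max t t₁) ht₁ (le_max_left _ _)
  -- lower side: K ≥ 1 geometric windows reaching a late time
  have hKex : ∃ K : ℕ, t₁ ≤ r ^ K * t := by
    have hlim : Tendsto (fun n : ℕ => r ^ n * t) atTop atTop :=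
      (tendsto_pow_atTop_atTop_of_one_lt hr).atTop_mul_const htpos
    exact (hlim.eventually_ge_atTop t₁).exists
  obtain ⟨K₀, hK₀⟩ := hKex
  have hK1 : 1 ≤ max K₀ 1 := le_max_right _ _
  have hKt : t₁ ≤ r ^ (max K₀ 1) * t := by
    have hpow : r ^ K₀ ≤ r ^ (max K₀ 1) := pow_le_pow_right₀ hr.le (le_max_left _ _)
    have : r ^ K₀ * t ≤ r ^ (max K₀ 1) * t := mul_le_mul_of_nonneg_right hpow htpos.le
    exact le_trans hK₀ this
  have hlow1 : ∀ᶠ M : ℕ in atTop, c / Real.sqrt t ≤ θ M (r ^ (max K₀ 1) * t) - θ M t :=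
    gain_iter hc hu₂ hr hgain (max K₀ 1) hK1 t ht₂
  have hlow2 : ∀ᶠ M : ℕ in atTop, |1 - θ M (r ^ (max K₀ 1) * t)| ≤ ε := hSR _ hKt
  filter_upwards [hb1, hb2, hlow1, hlow2] with M h1 h2 h3 h4
  have h4' := (abs_le.1 h4).1
  have h1' := (abs_le.1 h1).2
  have hsplit : c / Real.sqrt t - c / 2 / Real.sqrt t = c / 2 / Real.sqrt t := by ring
  have hadd : (C + c / 2) / Real.sqrt t = C / Real.sqrt t + c / 2 / Real.sqrt t := by ring
  constructor
  · -- c/2/√t ≤ 1 - θ M t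
    have : c / Real.sqrt t - ε ≤ 1 - θ M t := by linarith
    simpa [hε_def, hsplit] using this
  · rw [hadd]
    have : 1 - θ M t ≤ ε + C / Real.sqrt t := by linarith
    simpa [hε_def, add_comm] using this

/-- The tail law implies the sum rule. -/
theorem sumRule_of_tail {θ : ℕ → ℝ → ℝ} (hT : ATail θ) : ASumRule θ := by
  obtain ⟨c, C, t₀, hc, ht₀, h⟩ := hT
  intro ε hε
  refine ⟨max t₀ ((|C| / ε) ^ 2), ?_⟩
  intro t ht
  have ht₀t : t₀ ≤ t := le_trans (le_max_left _ _) ht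
  have htpos : 0 < t := lt_of_lt_of_le ht₀ ht₀t
  have hsq : 0 < Real.sqrt t := Real.sqrt_pos.2 htpos
  have hsqge : |C| / ε ≤ Real.sqrt t := by
    have h2 : (|C| / ε) ^ 2 ≤ t := le_trans (le_max_right _ _) ht
    have hnn : 0 ≤ |C| / ε := div_nonneg (abs_nonneg _) hε.le
    calc |C| / ε = Real.sqrt ((|C| / ε) ^ 2) := (Real.sqrt_sq hnn).symm
      _ ≤ Real.sqrt t := Real.sqrt_le_sqrt h2
  filter_upwards [h t ht₀t] with M hM
  rw [abs_le]
  constructor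
  · have : 0 ≤ c / Real.sqrt t := div_nonneg hc.le hsq.le
    linarith [hM.1]
  · have hCle : C / Real.sqrt t ≤ ε := by
      have hC1 : C / Real.sqrt t ≤ |C| / Real.sqrt t :=
        div_le_div_of_nonneg_right (le_abs_self C) hsq.le
      have hC2 : |C| / Real.sqrt t ≤ ε := by
        rw [div_le_iff₀ hsq]
        have := (div_le_iff₀ hε).1 hsqge
        linarith [this]
      exact le_trans hC1 hC2
    linarith [hM.2]

/-- The tail law implies the window ceiling (with the same `C`). -/
theorem ceiling_of_tail {θ : ℕ → ℝ → ℝ} (hT : ATail θ) : ACeiling θ := by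
  obtain ⟨c, C, t₀, hc, ht₀, h⟩ := hT
  refine ⟨C, t₀, ht₀, ?_⟩
  intro a b ha hab
  have hbpos : 0 < b := lt_of_lt_of_le (lt_of_lt_of_le ht₀ ha) hab
  filter_upwards [h a ha, h b (le_trans ha hab)] with M hMa hMb
  have : 0 ≤ c / Real.sqrt b := div_nonneg hc.le (Real.sqrt_nonneg _)
  linarith [hMa.2, hMb.1]

/-- The tail law implies the window gain, with ratio `r = max 4 (2C/c)²` and constant `c/2`. -/
theorem gain_of_tail {θ : ℕ → ℝ → ℝ} (hT : ATail θ) : AGain θ := by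
  obtain ⟨c, C, t₀, hc, ht₀, h⟩ := hT
  -- the filter `atTop` on `ℕ` is non-trivial, so the bracket at `t₀` forces `c ≤ C`
  have hcC : c ≤ C := by
    obtain ⟨M, hM⟩ := (h t₀ le_rfl).exists
    have hs : 0 < Real.sqrt t₀ := Real.sqrt_pos.2 ht₀
    exact (div_le_div_iff_of_pos_right hs).1 (le_trans hM.1 hM.2)
  have hCpos : 0 < C := lt_of_lt_of_le hc hcC
  set r : ℝ := max 4 ((2 * C / c) ^ 2) with hr_def
  have hr1 : 1 < r := lt_of_lt_of_le (by norm_num) (le_max_left _ _)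
  have hr0 : 0 ≤ r := le_trans (by norm_num) (le_max_left _ _)
  have hsr : 2 * C / c ≤ Real.sqrt r := by
    have hpos : 0 < 2 * C / c := by positivity
    rw [Real.le_sqrt' hpos]
    exact le_max_right _ _
  refine ⟨c / 2, t₀, r, by positivity, ht₀, hr1, ?_⟩
  intro a ha
  have hapos : 0 < a := lt_of_lt_of_le ht₀ ha
  have hsa : 0 < Real.sqrt a := Real.sqrt_pos.2 hapos
  have hra : t₀ ≤ r * a := by
    have : a ≤ r * a := by nlinarith
    exact le_trans ha this
  filter_upwards [h a ha, h (r * a) hra] with M hMa hMra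
  -- `C/√(r a) ≤ c/(2√a)` since `√r ≥ 2C/c`
  have hsqr : 0 < Real.sqrt r := lt_of_lt_of_le (by positivity) hsr
  have hkey : C / Real.sqrt (r * a) ≤ c / 2 / Real.sqrt a := by
    rw [Real.sqrt_mul hr0, div_le_div_iff₀ (by positivity) hsa]
    have h2C : 2 * C ≤ Real.sqrt r * c := by
      have := (div_le_iff₀ hc).1 hsr
      linarith
    nlinarith [h2C, hsa]
  have : c / Real.sqrt a - C / Real.sqrt (r * a) ≤ θ M (r * a) - θ M a := by linarith [hMa.1, hMra.2]
  have hsplit : c / 2 / Real.sqrt a ≤ c / Real.sqrt a - C / Real.sqrt (r * a) := by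
    have : c / Real.sqrt a - c / 2 / Real.sqrt a = c / 2 / Real.sqrt a := by ring
    linarith
  linarith

/-- The abstract trichotomy: tail law `⟺` sum rule ∧ window ceiling ∧ window gain. -/
theorem tail_iff (θ : ℕ → ℝ → ℝ) : ATail θ ↔ ASumRule θ ∧ ACeiling θ ∧ AGain θ :=
  ⟨fun h => ⟨sumRule_of_tail h, ceiling_of_tail h, gain_of_tail h⟩,
    fun h => tail_of_sumRule_ceiling_gain h.1 h.2.1 h.2.2⟩

/-! ## The two new pieces over the route's vocabulary (prefix and `let`-bindings VERBATIM the crux's) -/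

/-- **WindowCeiling** (time-local upper piece): for `pinnedChain ω₂ lam β γ` (all `> 0`) and `T > 0` there are `C` and `u₀ > 0`
with: for all `u₀ ≤ a ≤ b`, eventually in `M`, `θ_M(b) − θ_M(a) ≤ C/√a` — the boundary kinetic temperature gains at most `C/√a`
over any window starting at `a` (`(γ/T²)∫ₐᵇ K_M ≤ C/√a`: no super-diffusive recurrent channel).  TRUE at the harmonic corner. -/
def WindowCeiling : Prop :=
  ∀ ω₂ lam β γ : ℝ, 0 < ω₂ → 0 < lam → 0 < β → 0 < γ → ∀ T : ℝ, 0 < T → (let P := Literature.MathematicalPhysics.KineticTheory.HeatConduction.pinnedChain ω₂ lam β γ; let K : ℕ → ℝ → ℝ := fun N u => if h : 0 < N then ∫ z, ((z.2 ⟨0, h⟩) ^ 2 - T) * (∫ y, ((y.2 ⟨0, h⟩) ^ 2 - T) ∂(P.transitionKernel N T T u.toNNReal z)) ∂(P.gibbsMeasure N T) else 0; let θ : ℕ → ℝ → ℝ := fun N t => γ / T ^ 2 * ∫ u in (0 : ℝ)..t, K N u; ∃ C u₀ : ℝ, 0 < u₀ ∧ ∀ a b : ℝ, u₀ ≤ a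 → a ≤ b → ∀ᶠ M : ℕ in Filter.atTop, θ M b - θ M a ≤ C / Real.sqrt a)

/-- **WindowGain** (time-local lower piece): for `pinnedChain ω₂ lam β γ` (all `> 0`) and `T > 0` there are `c, u₀ > 0` and a
ratio `r > 1` with: for all `a ≥ u₀`, eventually in `M`, `c/√a ≤ θ_M(r·a) − θ_M(a)` — over one geometric window the boundary
still gains at least `c/√a` (diffusive recurrence floor).  FALSE at the harmonic corner (`∫ₐ^{ra} K^harm ≲ a⁻²`) and for a
sub-diffusive or localised bulk. -/
def WindowGain : Prop :=
  ∀ ω₂ lam β γ : ℝ, 0 < ω₂ → 0 < lam → 0 < β → 0 < γ → ∀ T : ℝ, 0 < T → (let P := Literature.MathematicalPhysics.KineticTheory.HeatConduction.pinnedChain ω₂ lam β γ; let K : ℕ → ℝ → ℝ := fun N u => if h : 0 < N then ∫ z, ((z.2 ⟨0, h⟩) ^ 2 - T) * (∫ y, ((y.2 ⟨0, h⟩) ^ 2 - T) ∂(P.transitionKernel N T T u.toNNReal z)) ∂(P.gibbsMeasure N T) else 0; let θ : ℕ → ℝ → ℝ := fun N t => γ / T ^ 2 * ∫ u in (0 :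 ℝ)..t, K N u; ∃ c u₀ r : ℝ, 0 < c ∧ 0 < u₀ ∧ 1 < r ∧ ∀ a : ℝ, u₀ ≤ a → ∀ᶠ M : ℕ in Filter.atTop, c / Real.sqrt a ≤ θ M (r * a) - θ M a)

open _root_.Summit.AtomisticToContinuum.FouriersLaw.Theses.BoundaryEscapeDeficit (SumRule HalfChainTailLaw)

/-- **The crux from the three pieces**: `SumRule → WindowCeiling → WindowGain → HalfChainTailLaw` (the `let`-bound `P, K, θ`
are syntactically identical across the four decls and are zeta-reduced by `dsimp only`; the seam is
`tail_of_sumRule_ceiling_gain`). -/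
theorem halfChainTailLaw_of_sumRule_windowCeiling_windowGain
    (hS : SumRule) (hU : WindowCeiling) (hG : WindowGain) : HalfChainTailLaw := by
  intro ω₂ lam β γ hω hl hβ hγ T hT
  have kS := hS ω₂ lam β γ hω hl hβ hγ T hT
  have kU := hU ω₂ lam β γ hω hl hβ hγ T hT
  have kG := hG ω₂ lam β γ hω hl hβ hγ T hT
  dsimp only at kS kU kG ⊢
  exact tail_of_sumRule_ceiling_gain kS kU kG

/-- Converse 1: the crux implies the route's support item `SumRule`. -/
theorem sumRule_of_halfChainTailLaw (hTail : HalfChainTailLaw) : SumRule := by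
  intro ω₂ lam β γ hω hl hβ hγ T hT
  have k := hTail ω₂ lam β γ hω hl hβ hγ T hT
  dsimp only at k ⊢
  exact sumRule_of_tail k

/-- Converse 2: the crux implies `WindowCeiling`. -/
theorem windowCeiling_of_halfChainTailLaw (hTail : HalfChainTailLaw) : WindowCeiling := by
  intro ω₂ lam β γ hω hl hβ hγ T hT
  have k := hTail ω₂ lam β γ hω hl hβ hγ T hT
  dsimp only at k ⊢
  exact ceiling_of_tail k

/-- Converse 3: the crux implies `WindowGain`. -/
theorem windowGain_of_halfChainTailLaw (hTail : HalfChainTailLaw) : WindowGain := by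
  intro ω₂ lam β γ hω hl hβ hγ T hT
  have k := hTail ω₂ lam β γ hω hl hβ hγ T hT
  dsimp only at k ⊢
  exact gain_of_tail k

/-- **The window trichotomy is lossless**: `HalfChainTailLaw ⟺ SumRule ∧ WindowCeiling ∧ WindowGain`. -/
theorem halfChainTailLaw_iff : HalfChainTailLaw ↔ SumRule ∧ WindowCeiling ∧ WindowGain :=
  ⟨fun h => ⟨sumRule_of_halfChainTailLaw h, windowCeiling_of_halfChainTailLaw h, windowGain_of_halfChainTailLaw h⟩,
    fun h => halfChainTailLaw_of_sumRule_windowCeiling_windowGain h.1 h.2.1 h.2.2⟩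

end Summit.AtomisticToContinuum.FouriersLaw.Cruxes.HalfChainTailLaw.StrategistS2

end
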